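import Mathlib
import HarnessLib
import Summits.AnomalousDissipation.AnomalousDissipation.Theses.MomentParity
import Literature.Analysis.FluidPDE.StatisticalSolution
import Literature.Analysis.FluidPDE.ZerothLaw
import Literature.Analysis.FunctionSpaces.TorusTrigPoly

/-!
# Crux `UniformResolution` (stmt-AnomalousDissipation-14330) — ideator 2, round 1: first lemmas

Sketch file: the `First lemma:` signatures of the two crux idea cards FILED by this ideator,
`amplitude-wavenumber-exchange` (§1) and `leak-certificates-see-the-cutoff` (§2), plus (§3) the
lemma candidates of a third, UNFILED line (`designed-dissipation-range-surgery`: order-by-order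
design of resolved pseudo-ensembles), kept for the lead as possible support items
(`CubicResolvedSurgery` is plausibly provable now).  Nothing is proved here; every
`def … : Prop` must elaborate (`lean check` rc 0, no sorry).

Notation: level-`N` fields, polynomial cylindrical stationarity and the resolution clause are
copied verbatim from `Summits/AnomalousDissipation/AnomalousDissipation/Theses/MomentParity.lean`
(decl `UniformResolution`).
-/

noncomputable section

open MeasureTheory Filter
open scoped ENNReal NNReal

namespace Summit.AnomalousDissipation.AnomalousDissipation.Cruxes.UniformResolution.Ideator2

/-- The energy space `H` of `T³` (abbreviation). -/
abbrev Hsp := Literature.Analysis.FunctionSpaces.Torus.energySpace (Fin 3)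

/-- The underlying field of `u ∈ H`. -/
abbrev fld (u : Hsp) : UnitAddTorus (Fin 3) → EuclideanSpace ℝ (Fin 3) :=
  (u.1 : UnitAddTorus (Fin 3) → EuclideanSpace ℝ (Fin 3))

/-- Spectral enstrophy `Z(u) = ‖∇u‖₂² ∈ [0,∞]`. -/
abbrev Z (u : Hsp) : ℝ≥0∞ := Literature.Analysis.FunctionSpaces.Torus.eGradNormSq (fld u)

/-- Spectral palinstrophy `|Au|² = ‖Δu‖₂² ∈ [0,∞]`. -/
abbrev Pal (u : Hsp) : ℝ≥0∞ := Literature.Analysis.FluidPDE.eLaplacianNormSq (fld u)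

/-- Resolved enstrophy `‖∇P_K u‖₂²`. -/
abbrev ZP (K : ℕ) (u : Hsp) : ℝ≥0∞ :=
  Literature.Analysis.FunctionSpaces.Torus.eGradNormSq
    (Literature.Analysis.FunctionSpaces.Torus.fourierTruncate K (fld u))

/-- A field is carried by the level-`N` Galerkin modes `0 < |k| ≤ N` (route clause, verbatim). -/
def IsLevelField (N : ℕ) (g : UnitAddTorus (Fin 3) → EuclideanSpace ℝ (Fin 3)) : Prop :=
  ∀ k ∉ (Literature.Analysis.FunctionSpaces.Torus.freqBall N).erase (0 : Fin 3 → ℤ),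
    UnitAddTorus.mFourierCoeff (Literature.Analysis.FunctionSpaces.EuclideanSpace.complexify ∘ g) k = 0

/-- `μ` is carried by level-`N` fields. -/
def IsLevel (N : ℕ) (μ : Measure Hsp) : Prop := ∀ᵐ u ∂μ, IsLevelField N (fld u)

/-- Admissible band-limited test fields (route clause, verbatim). -/
def IsTestField (N : ℕ) (g : UnitAddTorus (Fin 3) → EuclideanSpace ℝ (Fin 3)) : Prop :=
  Literature.Analysis.FunctionSpaces.Torus.IsSmooth g ∧ Literature.Analysis.FunctionSpaces.Torus.IsDivFree g ∧
    Literature.Analysis.FunctionSpaces.Torus.HasZeroMean g ∧ IsLevelField N g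

/-- The gradient field `∇V(u) = ∑ᵢ ∂ᵢP((u,g)) gᵢ` of the polynomial cylindrical functional
`V(u) = P((u,g₁),…,(u,gₘ))` (route clause, verbatim). -/
def polyGrad {m : ℕ} (g : Fin m → UnitAddTorus (Fin 3) → EuclideanSpace ℝ (Fin 3))
    (P : MvPolynomial (Fin m) ℝ) (u : Hsp) : UnitAddTorus (Fin 3) → EuclideanSpace ℝ (Fin 3) :=
  fun x => ∑ i : Fin m,
    (MvPolynomial.eval (fun j => Literature.Analysis.FluidPDE.Torus.pairing u.1 (g j))
      (MvPolynomial.pderiv i P)) • g i x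

/-- `d`-stationarity for Galerkin NS at `(ν, f)`, level `N`: every polynomial cylindrical
observable of degree `≤ d - 1` in band-limited pairings is drift-free (route clause, verbatim). -/
def IsPolyStationaryUpTo (ν : ℝ) (f : UnitAddTorus (Fin 3) → EuclideanSpace ℝ (Fin 3)) (N d : ℕ)
    (μ : Measure Hsp) : Prop :=
  ∀ (m : ℕ) (g : Fin m → UnitAddTorus (Fin 3) → EuclideanSpace ℝ (Fin 3)) (P : MvPolynomial (Fin m) ℝ),
    (∀ i, IsTestField N (g i)) → P.totalDegree + 1 ≤ d →
      Integrable (fun u => Literature.Analysis.FluidPDE.Torus.nsGeneratorPairing ν f u (polyGrad g P u)) μ ∧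
        ∫ u, Literature.Analysis.FluidPDE.Torus.nsGeneratorPairing ν f u (polyGrad g P u) ∂μ = 0

/-- Stationarity against polynomial cylindrical observables of all degrees (= the d = ∞ rung;
on compactly supported level-`N` measures this is Galerkin invariance). -/
def IsPolyStationary (ν : ℝ) (f : UnitAddTorus (Fin 3) → EuclideanSpace ℝ (Fin 3)) (N : ℕ)
    (μ : Measure Hsp) : Prop :=
  ∀ d : ℕ, IsPolyStationaryUpTo ν f N d μ

/-- The resolution clause of the crux with schedule `κ` (route clause, verbatim). -/
def IsResolved (κ : ℕ → ℕ) (μ : Measure Hsp) : Prop :=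
  ∀ n : ℕ, ∫⁻ u, Z u ∂μ ≤ (∫⁻ u, ZP (κ n) u ∂μ) + ((n : ℝ≥0∞) + 1)⁻¹

/-! ## §1 Card `amplitude-wavenumber-exchange` -/

/-- **L1a (renormalised palinstrophy).** Testing invariance against the bounded functional
`Φ(u) = -(1 + ‖∇u‖²)⁻¹` and bounding the vortex-stretching term by Agmon/Young gives an
`N`-uniform bound `∫ |Au|² / (1+Z)² dμ ≤ C(ν,f,R)` for every Galerkin-invariant law in `B_R`. -/
def RenormalisedPalinstrophy : Prop :=
  ∀ f : UnitAddTorus (Fin 3) → EuclideanSpace ℝ (Fin 3),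
    Literature.Analysis.FunctionSpaces.Torus.IsSmooth f → Literature.Analysis.FunctionSpaces.Torus.IsDivFree f →
    Literature.Analysis.FunctionSpaces.Torus.HasZeroMean f →
    ∀ ν : ℝ, 0 < ν → ∀ R : ℝ, ∃ C : ℝ, 0 ≤ C ∧
      ∀ (N : ℕ) (μ : Measure Hsp), IsProbabilityMeasure μ → IsLevel N μ → (∀ᵐ u ∂μ, ‖u‖ ≤ R) →
        IsPolyStationary ν f N μ →
          ∫⁻ u, Pal u / (1 + Z u) ^ 2 ∂μ ≤ ENNReal.ofReal C

/-- **L1b (amplitude-for-wavenumber exchange).** For Galerkin-invariant laws in `B_R` the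
enstrophy above wavenumber `K` is controlled by the enstrophy above AMPLITUDE `M` plus
`C(1+M)²/K²`, uniformly in the level `N`:
`∫ Z ≤ ∫ Z(P_K u) + C(1+M)²/K² + ∫_{Z > M} Z`. -/
def AmplitudeWavenumberExchange : Prop :=
  ∀ f : UnitAddTorus (Fin 3) → EuclideanSpace ℝ (Fin 3),
    Literature.Analysis.FunctionSpaces.Torus.IsSmooth f → Literature.Analysis.FunctionSpaces.Torus.IsDivFree f →
    Literature.Analysis.FunctionSpaces.Torus.HasZeroMean f →
    ∀ ν : ℝ, 0 < ν → ∀ R : ℝ, ∃ C : ℝ, 0 ≤ C ∧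
      ∀ (N : ℕ) (μ : Measure Hsp), IsProbabilityMeasure μ → IsLevel N μ → (∀ᵐ u ∂μ, ‖u‖ ≤ R) →
        IsPolyStationary ν f N μ →
        ∀ (K : ℕ) (M : ℝ), 0 < K → 0 ≤ M →
          ∫⁻ u, Z u ∂μ ≤
            (∫⁻ u, ZP K u ∂μ) + ENNReal.ofReal (C * (1 + M) ^ 2 / (K : ℝ) ^ 2) +
              ∫⁻ u in {u : Hsp | M < (Z u).toReal}, Z u ∂μ

/-- **L1c (glue: uniform integrability ⇒ a resolution schedule).** If a family of
Galerkin-invariant laws in `B_R` (any set of levels) has uniformly integrable enstrophy, one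
schedule `κ` resolves every member — the `κ`-clause of `UniformResolution`. -/
def UniformIntegrabilityGivesSchedule : Prop :=
  ∀ f : UnitAddTorus (Fin 3) → EuclideanSpace ℝ (Fin 3),
    Literature.Analysis.FunctionSpaces.Torus.IsSmooth f → Literature.Analysis.FunctionSpaces.Torus.IsDivFree f →
    Literature.Analysis.FunctionSpaces.Torus.HasZeroMean f →
    ∀ ν : ℝ, 0 < ν → ∀ (R : ℝ) (S : Set ℕ) (μ : ℕ → Measure Hsp),
      (∀ N ∈ S, IsProbabilityMeasure (μ N) ∧ IsLevel N (μ N) ∧ (∀ᵐ u ∂(μ N), ‖u‖ ≤ R) ∧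
        IsPolyStationary ν f N (μ N)) →
      (∀ η : ℝ, 0 < η → ∃ M : ℝ, ∀ N ∈ S,
        ∫⁻ u in {u : Hsp | M < (Z u).toReal}, Z u ∂(μ N) ≤ ENNReal.ofReal η) →
      ∃ κ : ℕ → ℕ, ∀ N ∈ S, IsResolved κ (μ N)

/-- **L1d (transfer target C⁺ of card 1: some loud family is enstrophy-tight).** The crux with
its `κ`-clause replaced by uniform integrability of `Z` (de la Vallée-Poussin form: a
superlinear Young weight `ψ` with bounded mean), budgets relaxed as in the crux. -/
def LoudFamilyEnstrophyTight : Prop :=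
  ∀ f : UnitAddTorus (Fin 3) → EuclideanSpace ℝ (Fin 3),
    Literature.Analysis.FunctionSpaces.Torus.IsSmooth f → Literature.Analysis.FunctionSpaces.Torus.IsDivFree f →
    Literature.Analysis.FunctionSpaces.Torus.HasZeroMean f →
    ∀ (ν : ℕ → ℝ) (E ε : ℝ), (∀ j, 0 < ν j) → Tendsto ν atTop (nhds 0) → 0 < ε →
      (∀ j : ℕ, ∃ R : ℝ, ∃ᶠ N in atTop, ∃ μ : Measure Hsp, IsProbabilityMeasure μ ∧ IsLevel N μ ∧
        (∀ᵐ u ∂μ, ‖u‖ ≤ R) ∧ IsPolyStationary (ν j) f N μ ∧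
        Literature.Analysis.FluidPDE.Torus.ensembleEnergy μ ≤ E ∧
        ε ≤ Literature.Analysis.FluidPDE.Torus.ensembleDissipation (ν j) μ) →
      ∃ E' ε' : ℝ, 0 < ε' ∧ ∀ j : ℕ, ∃ (R : ℝ) (ψ : ℝ → ℝ) (B : ℝ),
        Tendsto (fun z => ψ z / z) atTop atTop ∧
        ∃ᶠ N in atTop, ∃ μ : Measure Hsp, IsProbabilityMeasure μ ∧ IsLevel N μ ∧
          (∀ᵐ u ∂μ, ‖u‖ ≤ R) ∧ IsPolyStationary (ν j) f N μ ∧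
          ∫ u, ψ (Z u).toReal ∂μ ≤ B ∧ Integrable (fun u => ψ (Z u).toReal) μ ∧
          Literature.Analysis.FluidPDE.Torus.ensembleEnergy μ ≤ E' ∧
          ε' ≤ Literature.Analysis.FluidPDE.Torus.ensembleDissipation (ν j) μ

/-! ## §2 Card `leak-certificates-see-the-cutoff` -/

/-- Weighted enstrophy `G_w(u) = ∑_k w(k) ‖û(k)‖²` for a weight `w : ℤ³ → [0,∞]`
(think `w(k) = 4π²|k|² ω(|k|)` with `ω ↑ ∞`: a de la Vallée-Poussin weight in wavenumber). -/
def weightedEnstrophy (w : (Fin 3 → ℤ) → ℝ≥0∞) (u : Hsp) : ℝ≥0∞ :=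
  ∑' k : Fin 3 → ℤ,
    w k * (‖UnitAddTorus.mFourierCoeff (Literature.Analysis.FunctionSpaces.EuclideanSpace.complexify ∘ fld u) k‖₊ : ℝ≥0∞) ^ 2

/-- **L2a (leak certificates exist: Sion/Tobasco–Goluskin–Doering duality at level `N`).**
If at level `N` no Galerkin-invariant law in `B_R` is loud (`∫(f,u) ≥ ε'`) with weighted
enstrophy `≤ C`, then a polynomial cylindrical auxiliary functional certifies it pointwise on
the level-`N` ball: `G_w(u) - λ((f,u) - ε') + ⟨F(u), ∇V(u)⟩ ≥ C` for all level-`N` `u` with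
`‖u‖ ≤ R`. -/
def LeakCertificateExists : Prop :=
  ∀ f : UnitAddTorus (Fin 3) → EuclideanSpace ℝ (Fin 3),
    Literature.Analysis.FunctionSpaces.Torus.IsSmooth f → Literature.Analysis.FunctionSpaces.Torus.IsDivFree f →
    Literature.Analysis.FunctionSpaces.Torus.HasZeroMean f →
    ∀ ν : ℝ, 0 < ν → ∀ (N : ℕ) (R C ε' : ℝ) (w : (Fin 3 → ℤ) → ℝ≥0∞), (∀ k, w k ≠ ∞) →
      (¬ ∃ μ : Measure Hsp, IsProbabilityMeasure μ ∧ IsLevel N μ ∧ (∀ᵐ u ∂μ, ‖u‖ ≤ R) ∧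
          IsPolyStationary ν f N μ ∧ ε' ≤ ∫ u, Literature.Analysis.FluidPDE.Torus.pairing u.1 f ∂μ ∧
          ∫⁻ u, weightedEnstrophy w u ∂μ ≤ ENNReal.ofReal C) →
      ∃ (lam : ℝ) (m : ℕ) (g : Fin m → UnitAddTorus (Fin 3) → EuclideanSpace ℝ (Fin 3))
        (P : MvPolynomial (Fin m) ℝ), 0 ≤ lam ∧ (∀ i, IsTestField N (g i)) ∧
        ∀ u : Hsp, IsLevelField N (fld u) → ‖u‖ ≤ R →
          C ≤ (weightedEnstrophy w u).toReal - lam * (Literature.Analysis.FluidPDE.Torus.pairing u.1 f - ε') +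
            Literature.Analysis.FluidPDE.Torus.nsGeneratorPairing ν f u (polyGrad g P u)

/-- **L2b (the free limit step: a certificate of bounded complexity contradicts a loud
Foias–Prodi stationary statistical solution with `∫ G_w < ∞`).** If ONE polynomial cylindrical
certificate with test fields of level `≤ K₀` holds on the level-`N` balls for all large `N`,
then no stationary statistical solution supported in `B_R` with `∫(f,u) > ε'` (if `lam > 0`)
or `≥ ε'` has weighted enstrophy `< C`. (Contrapositive of the contradiction in the card; the
single limit measure always has SOME `w ↑ ∞` with `∫ G_w < ∞`.) -/
def BoundedCertificateContradictsLimit : Prop :=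
  ∀ f : UnitAddTorus (Fin 3) → EuclideanSpace ℝ (Fin 3),
    Literature.Analysis.FunctionSpaces.Torus.IsSmooth f → Literature.Analysis.FunctionSpaces.Torus.IsDivFree f →
    Literature.Analysis.FunctionSpaces.Torus.HasZeroMean f →
    ∀ ν : ℝ, 0 < ν → ∀ (K₀ : ℕ) (R C ε' lam : ℝ) (w : (Fin 3 → ℤ) → ℝ≥0∞) (m : ℕ)
      (g : Fin m → UnitAddTorus (Fin 3) → EuclideanSpace ℝ (Fin 3)) (P : MvPolynomial (Fin m) ℝ),
      0 ≤ lam → (∀ i, IsTestField K₀ (g i)) →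
      (∃ᶠ N in atTop, ∀ u : Hsp, IsLevelField N (fld u) → ‖u‖ ≤ R →
          C ≤ (weightedEnstrophy w u).toReal - lam * (Literature.Analysis.FluidPDE.Torus.pairing u.1 f - ε') +
            Literature.Analysis.FluidPDE.Torus.nsGeneratorPairing ν f u (polyGrad g P u)) →
      ∀ μ : Measure Hsp, Literature.Analysis.FluidPDE.Torus.IsStationaryStatisticalSolution ν f μ →
        (∀ᵐ u ∂μ, ‖u‖ ≤ R) → ε' ≤ ∫ u, Literature.Analysis.FluidPDE.Torus.pairing u.1 f ∂μ →
        Integrable (fun u => (weightedEnstrophy w u).toReal) μ → (∀ᵐ u ∂μ, weightedEnstrophy w u ≠ ∞) →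
          C ≤ ∫ u, (weightedEnstrophy w u).toReal ∂μ

/-! ## §3 (unfiled line) designed-dissipation-range surgery: lemma candidates -/

/-- **L3a (cubic resolved surgery: the `d = 3` rung of the crux with a designed tail).**
Whenever a loud 3-stationary level-`N` law in `B_R` exists, a loud 3-stationary level-`N` law
exists whose enstrophy is resolved by ONE schedule `κ₃ = κ₃(f,ν,E,ε,R)` independent of `N`
(order 3 is linear algebra in the third moments once the covariance is definite; the designed
covariance has an exponential dissipation range). -/
def CubicResolvedSurgery : Prop :=
  ∀ f : UnitAddTorus (Fin 3) → EuclideanSpace ℝ (Fin 3),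
    Literature.Analysis.FunctionSpaces.Torus.IsSmooth f → Literature.Analysis.FunctionSpaces.Torus.IsDivFree f →
    Literature.Analysis.FunctionSpaces.Torus.HasZeroMean f →
    ∀ ν : ℝ, 0 < ν → ∀ (E ε R : ℝ), 0 < ε →
      ∃ (E' ε' R' : ℝ) (κ : ℕ → ℕ), 0 < ε' ∧ ∀ N : ℕ,
        (∃ μ : Measure Hsp, IsProbabilityMeasure μ ∧ IsLevel N μ ∧ (∀ᵐ u ∂μ, ‖u‖ ≤ R) ∧
            IsPolyStationaryUpTo ν f N 3 μ ∧ Literature.Analysis.FluidPDE.Torus.ensembleEnergy μ ≤ E ∧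
            ε ≤ Literature.Analysis.FluidPDE.Torus.ensembleDissipation ν μ) →
        ∃ μ : Measure Hsp, IsProbabilityMeasure μ ∧ IsLevel N μ ∧ (∀ᵐ u ∂μ, ‖u‖ ≤ R') ∧
          IsPolyStationaryUpTo ν f N 3 μ ∧ IsResolved κ μ ∧
          Literature.Analysis.FluidPDE.Torus.ensembleEnergy μ ≤ E' ∧
          ε' ≤ Literature.Analysis.FluidPDE.Torus.ensembleDissipation ν μ

/-- **L3b (the line's crux: order-uniform designed surgery).** The same with `3` replaced by
every `d`, the schedule and budgets NOT depending on `d` (then `MomentClosure` at each good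
level gives the invariant resolved loud law and `UniformResolution` follows). -/
def OrderUniformResolvedSurgery : Prop :=
  ∀ f : UnitAddTorus (Fin 3) → EuclideanSpace ℝ (Fin 3),
    Literature.Analysis.FunctionSpaces.Torus.IsSmooth f → Literature.Analysis.FunctionSpaces.Torus.IsDivFree f →
    Literature.Analysis.FunctionSpaces.Torus.HasZeroMean f →
    ∀ ν : ℝ, 0 < ν → ∀ (E ε R : ℝ), 0 < ε →
      ∃ (E' ε' R' : ℝ) (κ : ℕ → ℕ), 0 < ε' ∧ ∀ N d : ℕ,
        (∃ μ : Measure Hsp, IsProbabilityMeasure μ ∧ IsLevel N μ ∧ (∀ᵐ u ∂μ, ‖u‖ ≤ R) ∧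
            IsPolyStationary ν f N μ ∧ Literature.Analysis.FluidPDE.Torus.ensembleEnergy μ ≤ E ∧
            ε ≤ Literature.Analysis.FluidPDE.Torus.ensembleDissipation ν μ) →
        ∃ μ : Measure Hsp, IsProbabilityMeasure μ ∧ IsLevel N μ ∧ (∀ᵐ u ∂μ, ‖u‖ ≤ R') ∧
          IsPolyStationaryUpTo ν f N d μ ∧ IsResolved κ μ ∧
          Literature.Analysis.FluidPDE.Torus.ensembleEnergy μ ≤ E' ∧
          ε' ≤ Literature.Analysis.FluidPDE.Torus.ensembleDissipation ν μ

end Summit.AnomalousDissipation.AnomalousDissipation.Cruxes.UniformResolution.Ideator2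

end
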